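import Summits.NavierStokesRegularity.NavierStokesRegularity.Theorems.OddMorawetzLocal.Negative.OddMorawetzLocalRefutationData5
import Summits.NavierStokesRegularity.NavierStokesRegularity.Theorems.OddMorawetzLocal.Negative.OddMorawetzLocalRefutationDefsVI
import HarnessLib

/-!
# Crux `OddMorawetzLocal` (stmt-NavierStokesRegularity-1376) — kernel certificates, weight 5 (part B4)

The finite computations of the weight-5 half of the refutation, each a closed Boolean evaluated by the kernel
(`decide +kernel`) on the vocabulary of `OddMorawetzLocalJetAlgebra` / `…RefutationDefs{,Fast,IV,V,VI}` and the literal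
data of `…RefutationData5` (197 representatives, 50 isotropic descriptors, certificate blocks of 53/45/49 rows, prime 8191).
Part B4: the modular independence certificate of the isotropic basis in orbit coordinates, row-chunked (`isoCertCheckRows`,
3 rows per theorem).
No analysis; lands `--supports` the crux item; consumed by the weight-5 assembly of the refutation.
-/

set_option linter.dupNamespace false

namespace Summit.NavierStokesRegularity.NavierStokesRegularity.Theorems.OddMorawetz

/-- Independence certificate of the weight-5 isotropic basis, rows `0 … 2`: `S_K · C = 1 (mod 8191)` on these rows. -/
theorem cert5_isoRows_0 : isoCertCheckRows reps5 isoDesc5 kcols5 cinv5 certPrime5 0 3 = true := by decide +kernel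

/-- Independence certificate of the weight-5 isotropic basis, rows `3 … 5`: `S_K · C = 1 (mod 8191)` on these rows. -/
theorem cert5_isoRows_1 : isoCertCheckRows reps5 isoDesc5 kcols5 cinv5 certPrime5 3 3 = true := by decide +kernel

/-- Independence certificate of the weight-5 isotropic basis, rows `6 … 8`: `S_K · C = 1 (mod 8191)` on these rows. -/
theorem cert5_isoRows_2 : isoCertCheckRows reps5 isoDesc5 kcols5 cinv5 certPrime5 6 3 = true := by decide +kernel

/-- Independence certificate of the weight-5 isotropic basis, rows `9 … 11`: `S_K · C = 1 (mod 8191)` on these rows. -/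
theorem cert5_isoRows_3 : isoCertCheckRows reps5 isoDesc5 kcols5 cinv5 certPrime5 9 3 = true := by decide +kernel

/-- Independence certificate of the weight-5 isotropic basis, rows `12 … 14`: `S_K · C = 1 (mod 8191)` on these rows. -/
theorem cert5_isoRows_4 : isoCertCheckRows reps5 isoDesc5 kcols5 cinv5 certPrime5 12 3 = true := by decide +kernel

/-- Independence certificate of the weight-5 isotropic basis, rows `15 … 17`: `S_K · C = 1 (mod 8191)` on these rows. -/
theorem cert5_isoRows_5 : isoCertCheckRows reps5 isoDesc5 kcols5 cinv5 certPrime5 15 3 = true := by decide +kernel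

/-- Independence certificate of the weight-5 isotropic basis, rows `18 … 20`: `S_K · C = 1 (mod 8191)` on these rows. -/
theorem cert5_isoRows_6 : isoCertCheckRows reps5 isoDesc5 kcols5 cinv5 certPrime5 18 3 = true := by decide +kernel

/-- Independence certificate of the weight-5 isotropic basis, rows `21 … 23`: `S_K · C = 1 (mod 8191)` on these rows. -/
theorem cert5_isoRows_7 : isoCertCheckRows reps5 isoDesc5 kcols5 cinv5 certPrime5 21 3 = true := by decide +kernel

/-- Independence certificate of the weight-5 isotropic basis, rows `24 … 26`: `S_K · C = 1 (mod 8191)` on these rows. -/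
theorem cert5_isoRows_8 : isoCertCheckRows reps5 isoDesc5 kcols5 cinv5 certPrime5 24 3 = true := by decide +kernel

/-- Independence certificate of the weight-5 isotropic basis, rows `27 … 29`: `S_K · C = 1 (mod 8191)` on these rows. -/
theorem cert5_isoRows_9 : isoCertCheckRows reps5 isoDesc5 kcols5 cinv5 certPrime5 27 3 = true := by decide +kernel

/-- Independence certificate of the weight-5 isotropic basis, rows `30 … 32`: `S_K · C = 1 (mod 8191)` on these rows. -/
theorem cert5_isoRows_10 : isoCertCheckRows reps5 isoDesc5 kcols5 cinv5 certPrime5 30 3 = true := by decide +kernel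

/-- Independence certificate of the weight-5 isotropic basis, rows `33 … 35`: `S_K · C = 1 (mod 8191)` on these rows. -/
theorem cert5_isoRows_11 : isoCertCheckRows reps5 isoDesc5 kcols5 cinv5 certPrime5 33 3 = true := by decide +kernel

/-- Independence certificate of the weight-5 isotropic basis, rows `36 … 38`: `S_K · C = 1 (mod 8191)` on these rows. -/
theorem cert5_isoRows_12 : isoCertCheckRows reps5 isoDesc5 kcols5 cinv5 certPrime5 36 3 = true := by decide +kernel

/-- Independence certificate of the weight-5 isotropic basis, rows `39 … 41`: `S_K · C = 1 (mod 8191)` on these rows. -/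
theorem cert5_isoRows_13 : isoCertCheckRows reps5 isoDesc5 kcols5 cinv5 certPrime5 39 3 = true := by decide +kernel

/-- Independence certificate of the weight-5 isotropic basis, rows `42 … 44`: `S_K · C = 1 (mod 8191)` on these rows. -/
theorem cert5_isoRows_14 : isoCertCheckRows reps5 isoDesc5 kcols5 cinv5 certPrime5 42 3 = true := by decide +kernel

/-- Independence certificate of the weight-5 isotropic basis, rows `45 … 47`: `S_K · C = 1 (mod 8191)` on these rows. -/
theorem cert5_isoRows_15 : isoCertCheckRows reps5 isoDesc5 kcols5 cinv5 certPrime5 45 3 = true := by decide +kernel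

/-- Independence certificate of the weight-5 isotropic basis, rows `48 … 49`: `S_K · C = 1 (mod 8191)` on these rows. -/
theorem cert5_isoRows_16 : isoCertCheckRows reps5 isoDesc5 kcols5 cinv5 certPrime5 48 2 = true := by decide +kernel

end Summit.NavierStokesRegularity.NavierStokesRegularity.Theorems.OddMorawetz
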